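import Mathlib

/-!
# T6A3DirectSumInj — injectivity of a degree-respecting map between direct sums (Mathlib-only helper)

Cell pub-hodge-repro2, Tier 6 (README §10), seat t6-p3 (A3 owner). Proof lane; carrier-free, Mathlib
only. A linear map `⨁_i M i → ⨁_k N k` assembled from maps `u i : M i → N (d i)` («degree `i` lands in
degree `d i`») is injective as soon as, for every `k`, the assembled map on the fibre
`⨁_{i : d i = k} M i → N k` is injective (the summands of different total degree cannot cancel). Used by
T6A3HostKunnethIso for the injectivity of the Künneth algebra map (total degree `i + j`).

§8(d): uses an L-value-free non-vanishing device: NO.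
-/

namespace Summit.Ventures.HodgeRepro2.T6.DirectSumInj

open DirectSum

variable {R : Type*} [Semiring R] {ι κ : Type*} [DecidableEq ι] [DecidableEq κ]
  {M : ι → Type*} [∀ i, AddCommMonoid (M i)] [∀ i, Module R (M i)]
  {N : κ → Type*} [∀ k, AddCommMonoid (N k)] [∀ k, Module R (N k)]
  (d : ι → κ) (u : ∀ i, M i →ₗ[R] N (d i))

/-- The assembled map `⨁_i M i → ⨁_k N k`, `lof i x ↦ lof (d i) (u i x)`. -/
noncomputable def assemble : (⨁ i, M i) →ₗ[R] ⨁ k, N k :=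
  DirectSum.toModule R ι (⨁ k, N k) fun i => (DirectSum.lof R κ N (d i)).comp (u i)

/-- Transport along an equality of degrees. -/
def castN {k₁ k₂ : κ} (h : k₁ = k₂) : N k₁ →ₗ[R] N k₂ := by
  subst h
  exact LinearMap.id

/-- The fibre map at `k`: `⨁_{i : d i = k} M i → N k`. -/
noncomputable def fibreMap (k : κ) : (⨁ i : {i // d i = k}, M i.1) →ₗ[R] N k :=
  DirectSum.toModule R {i // d i = k} (N k) fun i => (castN (N := N) i.2).comp (u i.1)

variable (R) in
/-- The restriction to the fibre over `k`: `lof i x ↦ lof ⟨i, _⟩ x` if `d i = k`, `0` otherwise. -/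
noncomputable def restrict (k : κ) : (⨁ i, M i) →ₗ[R] ⨁ i : {i // d i = k}, M i.1 :=
  DirectSum.toModule R ι _ fun i =>
    if h : d i = k then DirectSum.lof R {i // d i = k} (fun i => M i.1) ⟨i, h⟩ else 0


/-- The `k`-th component of the assembled map is the fibre map applied to the restriction. -/
theorem assemble_apply_eq (z : ⨁ i, M i) (k : κ) :
    assemble d u z k = fibreMap d u k (restrict R d k z) := by
  classical
  induction z using DirectSum.induction_on with
  | zero => simp [map_zero]
  | of i x =>
    rw [← DirectSum.lof_eq_of R]
    simp only [assemble, restrict, DirectSum.toModule_lof, LinearMap.comp_apply]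
    by_cases h : d i = k
    · subst h
      simp only [dif_pos, fibreMap, DirectSum.toModule_lof, LinearMap.comp_apply, DirectSum.lof_apply]
      rfl
    · rw [dif_neg h, LinearMap.zero_apply, map_zero, DirectSum.lof_eq_of,
        DirectSum.of_eq_of_ne _ _ _ (Ne.symm h)]
  | add x y hx hy =>
    rw [map_add, DirectSum.add_apply, hx, hy, map_add, map_add]


/-- The `⟨i, rfl⟩`-component of the restriction to the fibre over `d i` is the `i`-th component. -/
theorem restrict_apply_self (w : ⨁ i, M i) (i : ι) : restrict R d (d i) w ⟨i, rfl⟩ = w i := by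
  classical
  induction w using DirectSum.induction_on with
  | zero => simp
  | of i' x =>
    rw [← DirectSum.lof_eq_of R]
    simp only [restrict, DirectSum.toModule_lof]
    by_cases h : d i' = d i
    · rw [dif_pos h]
      by_cases hi : i' = i
      · subst hi
        simp
      · rw [DirectSum.lof_eq_of, DirectSum.of_eq_of_ne _ _ _ (fun e => hi (congrArg Subtype.val e).symm),
          DirectSum.lof_eq_of, DirectSum.of_eq_of_ne _ _ _ (Ne.symm hi)]
    · rw [dif_neg h, LinearMap.zero_apply, DirectSum.zero_apply, DirectSum.lof_eq_of,
        DirectSum.of_eq_of_ne _ _ _ (fun e => h (by rw [e]))]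
  | add x y hx hy => rw [map_add, DirectSum.add_apply, hx, hy, DirectSum.add_apply]

/-- Two elements with the same fibre restrictions are equal. -/
theorem ext_of_restrict {z w : ⨁ i, M i} (h : ∀ k, restrict R d k z = restrict R d k w) : z = w := by
  refine DirectSum.ext _ fun i => ?_
  rw [← restrict_apply_self (R := R) d z i, ← restrict_apply_self (R := R) d w i, h (d i)]

/-- INJECTIVITY of the assembled map `⨁_i M i → ⨁_k N k` from the injectivity of every fibre map
`⨁_{i : d i = k} M i → N k`. -/
theorem assemble_injective (hfib : ∀ k, Function.Injective (fibreMap d u k)) :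
    Function.Injective (assemble d u) := by
  intro z w hzw
  refine ext_of_restrict (R := R) d fun k => hfib k ?_
  rw [← assemble_apply_eq, ← assemble_apply_eq, hzw]

end Summit.Ventures.HodgeRepro2.T6.DirectSumInj
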